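import Summits.BirchSwinnertonDyer.Rank1Residual.X11b.Three.ClassRecordKoly
import Summits.BirchSwinnertonDyer.Rank1Residual.X11b.RungK2Leaves
import HarnessLib

/-!
# Routes `ClassRecordThree` / `KolyvaginRoadThree` (rung K2@3): the `p = 3` class records RE-KEYED on the
# CONSUMED upper bound — the Shimura-displays binder `hSh` replaced by the Euler-system half it produces
# (kernel siblings for the planner's SHIM cash-in; cell `bsd-stepL`, seat `bsd-stepL-shim-p1` g2)

`--supports stmt-BirchSwinnertonDyer-19110` (shared crux `ShimuraDisplaysAtThree` of the two K2@3 routes), as a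
HELPER: no route decl is closed here. Planner's hand task `plan/SHIM-CASHIN/PACKAGE.md` (2026-08-26).

## What this file does

The class record at `3` — `Three.bsdp_three_of_surj_of_stepLAt_of_shapes` (`X11b/Three/ClassRecordAtThree.lean`
:195), carried to the leaf by `Three.forall_bsdp_of_classRecord_v45'` (`ClassRecordEP.lean`) →
`X11b.multiplicativeRankOneAtThree_of_classRecord` (`RungK2Leaves.lean` §2), and its Kolyvagin-road twin
`Three.forall_bsdp_of_kolyRecord` (`ClassRecordKoly.lean`) → `X11b.multiplicativeRankOneAtThree_of_kolyRecord`
(`Theorems/RungK2HubKoly.lean`) — consumes the print-shaped Shimura displays `X11b.P2ShimuraDisplaysAt W 3`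
(binder `hSh`, crux `ShimuraDisplaysAtThree`, item 19110) at exactly ONE line: on the pure-(T2β)@3 sub-atom
((ram) ∧ ¬(T2α)@3 ∧ ¬(T2γ)@3 ∧ `3 ∣ ∏c`) it feeds them to
`Three.missingUpperBoundAt_of_ram_of_not_alpha_of_shape_of_barriosEtAl` to get the Euler-system half
`Typed.MissingUpperBoundAt W 3`. That half is now a THEOREM from published named facts
(`classRecordThree_shimuraUpperHalfAtThree_of_published`, `Theorems/ClassRecordThreeShimuraUpperHalf.lean`,
p422736: Jacquet–Langlands + Pasten 2024 §6 + Cai–Shu–Tian 2014 Thm. 1.5 / JSW 2017 Thm. 4.4.1), whereas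
the displays AS STATED also ask instances at inert sets `S ∋ 3` that are not in print. So this file re-keys the
kernels on the CONSUMED bound:

* §1 `Three.bsdp_three_of_surj_of_stepLAt_of_shapes_upper` — the per-pair road-(b)/(d) kernel VERBATIM with
  `hSh : … → P2ShimuraDisplaysAt W 3` replaced by `hUβ : Ram W 3 → ¬ShapeAlpha W → ¬ShapeGamma W → 3 ∣ ∏c →
  Typed.MissingUpperBoundAt W 3` and the one `exact …barriosEtAl… (hSh hram hα hγ ht)` line replaced by
  `exact hUβ hram hα hγ ht` (the binders `hFH`, `hBR` of the original, used only on that line, drop out);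
* §2 `multiplicativeRankOneAtThree_of_classRecord_upper` — the leaf `X11b.MultiplicativeRankOneAtThree` from the
  binders of `X11b.multiplicativeRankOneAtThree_of_classRecord` (class record v4.5′) with `hSh` replaced by the
  class-wide `hUβ` (and `hFH`, `hBR` dropped); proof = the record's pointwise case split (as
  `Three.forall_bsdp_of_kolyRecord` spells it out: road (a) `bsdp_of_ram_of_nonsplit_of_regulatorNonvanishing`,
  roads (b)/(d) §1 with `StepLAt W` from `stepLAt_of_halves₃_of_classX11b` ∘ `bdpExistsAt₃_of_hsieh2014_of_descent`
  ∘ `lambdaSupplyAt₃`, the corner via `missingPPartAt_of_corner_*_of_inputs` + `missingUpperBoundAt_of_cornerUpperAt`,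
  `hEP` := `GaloisImage.EP.localEulerPoincareCharacteristic_adicCompletion`);
* §3 `multiplicativeRankOneAtThree_of_kolyRecord_upper` — the same substitution in the KOLY record's leaf theorem.

The re-glued `closes` terms of the two routes (crux `ShimuraDisplaysAtThree` → a by-name support item
`ShimuraCurveInputs := nonempty_shimuraParametrizationData ∧ PastenShimura2024_ribetTakahashiPackage ∧
shimuraCurve_heegnerPoint_grossZagier_kolyvagin`) are §2 / §3 applied with
`hUβ := fun W _ _ hX hram _ hα hγ _ ↦ classRecordThree_shimuraUpperHalfAtThree_of_published hSk hGZK hmod hnf hFH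
hMaz hBR hJL hRT hHK W hX hram hα hγ` (companion file `ClassRecordThreeShimuraCashIn.lean`, which imports the
route files; THIS module imports no `Theses` file, so a route file may import it).

HONEST FRAMING: THEOREMS ONLY (no definition, no named fact, no `sorry`); no new mathematics — kernel
re-plumbing; CONDITIONAL on every binder; nothing booked; O2 stays OPEN; BSD is not proved by any of this.

References: those of `ClassRecordAtThree.lean` / `ClassRecordKoly.lean` — [Skinner2016PacificMC] Thm. A, Thm. C;
[SteinWuthrich2013] Thm. 6.1, §4.2; [Disegni2020] Thm. 1; [Castella2018] Thm. 2.3, Thm. 3.2; [MatarNekovar2019]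
Thm. 0.3; [Hsieh2014] Thm. 1; [McCallumLMS1991] Cor. 5.6; [Wuthrich2014] Prop. 21; [Miller2011LMS] Def. 1.1.
-/

noncomputable section

open scoped Classical

open WeierstrassCurve NumberField IsDedekindDomain Field Literature.NumberTheory.EllipticCurves
  Rat.HeightOneSpectrum
  Literature.NumberTheory.DiophantineGeometry
  Literature.NumberTheory.EllipticCurves.GreenbergSelmer
  Literature.NumberTheory.EllipticCurves.ModularForms
  Literature.NumberTheory.EllipticCurves.Rank1Residual
  Literature.NumberTheory.EllipticCurves.Rank1Residual.Typed
  Literature.NumberTheory.EllipticCurves.Wuthrich2014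
  Literature.NumberTheory.EllipticCurves.BalakrishnanEtAl2019
  Literature.NumberTheory.EllipticCurves.Skinner2016
  Literature.NumberTheory.EllipticCurves.SteinWuthrich2013
  Literature.NumberTheory.EllipticCurves.Disegni2020
  Literature.NumberTheory.EllipticCurves.BarriosEtAl2025
  Literature.NumberTheory.QuadraticFields.Quadratic
  Literature.NumberTheory.Automorphic
  Literature.NumberTheory.GaloisRepresentations Literature.NumberTheory.GaloisCohomology
  Summit.BirchSwinnertonDyer.Rank1Residual.X11b.AcSelmer
  Summit.BirchSwinnertonDyer.Rank1Residual.X11b.LocBridge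
  Summit.BirchSwinnertonDyer.Rank1Residual
  Summit.BirchSwinnertonDyer.Rank1Residual.X11b
  Summit.BirchSwinnertonDyer.Rank1Residual.X11b.Three

-- the cell's Theorems namespace repeats the summit name (Summit.<Summit>.<Problem>), as in every sibling file
set_option linter.dupNamespace false

namespace Summit.BirchSwinnertonDyer.BirchSwinnertonDyer.Theorems

/-! ### §1. Roads (b)/(d) at the pair, the pure-β upper half CONSUMED (not displayed) -/

/-- **ROADS (b)/(d) AT ONE PAIR — X11b@3, `Surj`, STEP L AT THE PAIR, the pure-(T2β)@3 upper half as a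
BINDER on the consumed bound.** `Three.bsdp_three_of_surj_of_stepLAt_of_shapes` (x11b3-p3,
`ClassRecordAtThree.lean` :195) VERBATIM except: the displays binder `hSh : Ram W 3 → ¬ShapeAlpha W →
¬ShapeGamma W → 3 ∣ ∏c → P2ShimuraDisplaysAt W 3` is replaced by the Euler-system half it was used to produce,
`hUβ : Ram W 3 → ¬ShapeAlpha W → ¬ShapeGamma W → 3 ∣ ∏c → Typed.MissingUpperBoundAt W 3`, and the line
`exact missingUpperBoundAt_of_ram_of_not_alpha_of_shape_of_barriosEtAl … (hSh hram hα hγ ht)` by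
`exact hUβ hram hα hγ ht`; the published binders `hFH` (Friedberg–Hoffstein) and `hBR` (Barrios et al. 2025),
consumed only on that line, are no longer arguments. Lower half: `P2.missingLowerBoundAt_of_openInputOddAt` fed
by `p2OpenInputOnTreeOddAt_of_stepLAt`; upper half: A1 unconditional
(`missingUpperBoundAt_of_classX11b_of_ram_of_not_dvd`), (T2α)@3 `hUα`, (T2γ)@3∖α `hUγ`, pure-β `hUβ`, off (ram)
`hU₀`. CONDITIONAL; nothing booked; O2 OPEN.
-- adapted from Summits/BirchSwinnertonDyer/Rank1Residual/X11b/Three/ClassRecordAtThree.lean (:195–238)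
[cite: JetchevSkinnerWan2017, §7.4.1–7.4.2 (pp. 30–31)] [cite: Castella2018, Thm. 2.3 (p. 5), Thm. 3.2 (p. 9)]
[cite: Skinner2016PacificMC, Thm. C (§1) and footnote 1] [cite: Wuthrich2014, Prop. 21 (p. 400)]
[cite: Mazur1978, Cor. 4.1] [cite: Miller2011LMS, Def. 1.1] -/
theorem Three.bsdp_three_of_surj_of_stepLAt_of_shapes_upper [Fact (Nat.Prime 3)]
    (hGZ : ∀ (N : ℕ) [NeZero N] (W : WeierstrassCurve ℚ) (K : Type) [Field K] [NumberField K],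
      gross_zagier N W K)
    (hKo : ∀ (N : ℕ) [NeZero N] (W : WeierstrassCurve ℚ) (K : Type) [Field K] [NumberField K],
      kolyvagin N W K)
    (hB : ∀ (N : ℕ) [NeZero N] (W : WeierstrassCurve ℚ) (K : Type) [Field K] [NumberField K],
      Kolyvagin1990_padicValNat_card_sha_le N W K)
    (hSk : Skinner2016.thmC_padicValRat_bsd_rank_zero) (hWu : sha_dvd_analyticSha)
    (hGZK : rank_eq_analyticRank_of_analyticRank_le_one) (hmod : hasEntireLFunction_rat)
    (hnf : exists_isNewformOf) (hHL : HoffsteinLuo1997_exists_twist_L_one_ne_zero)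
    (hMaz : mazur_not_dvd_maninConstant_of_odd)
    (hPT : ∀ (K : Type) [Field K] [NumberField K], poitouTate_sum_localTatePairing_eq_zero K)
    (hEP : ∀ (K : Type) [Field K] [NumberField K] (v : HeightOneSpectrum (𝓞 K)),
      localEulerPoincareCharacteristic (v.adicCompletion K))
    (W : WeierstrassCurve ℚ) [W.IsElliptic] [W.IsGloballyMinimal] (hX : ClassX11b W 3)
    (hsurj : Surj W 3)
    -- STEP L AT THE PAIR (S0 currency)
    (hL : StepLAt W)
    -- pure-(T2β)@3: the CONSUMED Euler-system half (a theorem from published facts, p422736)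
    (hUβ : Ram W 3 → ¬ ShapeAlpha W → ¬ ShapeGamma W → 3 ∣ W.tamagawaProduct →
      Typed.MissingUpperBoundAt W 3)
    -- (T2α)@3
    (hUα : Ram W 3 → ShapeAlpha W → Typed.MissingUpperBoundAt W 3)
    -- (T2γ)@3, off (T2α)
    (hUγ : Ram W 3 → ¬ ShapeAlpha W → ShapeGamma W → Typed.MissingUpperBoundAt W 3)
    -- off (ram)
    (hU₀ : ¬ Ram W 3 → Typed.MissingUpperBoundAt W 3) : BSDp W 3 := by
  refine Typed.bsdp_of_missingPPartAt W 3 hGZK (by rw [hX.1]) ?_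
  refine Typed.missingPPartAt_of_lower_of_upper W 3
    (P2.missingLowerBoundAt_of_openInputOddAt W 3 hGZ hKo hWu hGZK hmod hnf hHL hMaz hPT hEP
      (p2OpenInputOnTreeOddAt_of_stepLAt hL) hX hsurj) ?_
  by_cases hram : Ram W 3
  · by_cases ht : 3 ∣ W.tamagawaProduct
    · by_cases hα : ShapeAlpha W
      · exact hUα hram hα
      by_cases hγ : ShapeGamma W
      · exact hUγ hram hα hγ
      exact hUβ hram hα hγ ht
    · exact missingUpperBoundAt_of_classX11b_of_ram_of_not_dvd hGZ hKo hB hSk hGZK hmod hnf hHL hMaz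
        integral_neronScaling_of_isGloballyMinimal_holds W 3 hX hram ht
  · exact hU₀ hram

/-! ### §2. The K2@3 leaf from the class record v4.5′, re-keyed on the consumed bound -/

/-- **K2b leaf from the class record v4.5′, the displays binder replaced by the CONSUMED upper bound.**
`X11b.multiplicativeRankOneAtThree_of_classRecord` (`RungK2Leaves.lean` §2 = `Three.forall_bsdp_of_classRecord_v45'`)
with its binder `hSh : ∀ W, ClassX11b W 3 → Ram W 3 → split at 3 → ¬ShapeAlpha W → ¬ShapeGamma W → 3 ∣ ∏c →
P2ShimuraDisplaysAt W 3` REPLACED by `hUβ : ∀ W, (same antecedents) → Typed.MissingUpperBoundAt W 3` — the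
bound the record consumed the displays for, now a theorem from published facts
(`classRecordThree_shimuraUpperHalfAtThree_of_published`, p422736) — and the two published binders `hFH`, `hBR`
(used only to consume `hSh`) dropped; every other binder VERBATIM (eighteen published facts without `hEP`;
road (a) `hReg`; road (b) `hDb`, `hHb`; (T2′)₃ `hUα`, `hUγ`; road (d) `hDd`, `hHd`, `hU₀`; corner `hCL`, `hCT`,
`hCU`). Proof: the record's pointwise case split — road (b) ∕ (d) = §1 with `StepLAt W` from
`stepLAt_of_halves₃_of_classX11b` ∘ `bdpExistsAt₃_of_hsieh2014_of_descent` ∘ `lambdaSupplyAt₃` (v4.3–v4.5), road (a)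
= `bsdp_of_ram_of_nonsplit_of_regulatorNonvanishing`, the corner = `missingPPartAt_of_corner_*_of_inputs` with
`missingUpperBoundAt_of_cornerUpperAt` (v4.1), `hEP` := `GaloisImage.EP.localEulerPoincareCharacteristic_adicCompletion`
(v4.5′). No new mathematics. CONDITIONAL on every binder; nothing booked; O2 OPEN.
-- adapted from Summits/BirchSwinnertonDyer/Rank1Residual/X11b/Three/ClassRecordKoly.lean (pointwise form)
[cite: Castella2018, Thm. 2.3 (p. 5), Thm. 3.2 (p. 9), §5 (p. 12)] [cite: Skinner2016PacificMC, Thm. A and Thm. C (§1)]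
[cite: SteinWuthrich2013, Thm. 6.1, §4.2] [cite: Disegni2020, Thm. 1 (§1.2)] [cite: MatarNekovar2019, Thm. 0.3 (p. 456)]
[cite: Hsieh2014, Thm. 1 (arXiv:1112.1580 pp. 3–4)] [cite: Wuthrich2014, Prop. 21 (p. 400)] [cite: Miller2011LMS, Def. 1.1] -/
theorem multiplicativeRankOneAtThree_of_classRecord_upper
    -- PUBLISHED: the named facts of route p2, WITHOUT `hEP` (as v4.5′)
    (hGZ : ∀ (N : ℕ) [NeZero N] (W : WeierstrassCurve ℚ) (K : Type) [Field K] [NumberField K],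
      gross_zagier N W K)
    (hKo : ∀ (N : ℕ) [NeZero N] (W : WeierstrassCurve ℚ) (K : Type) [Field K] [NumberField K],
      kolyvagin N W K)
    (hB : ∀ (N : ℕ) [NeZero N] (W : WeierstrassCurve ℚ) (K : Type) [Field K] [NumberField K],
      Kolyvagin1990_padicValNat_card_sha_le N W K)
    (hSk : Skinner2016.thmC_padicValRat_bsd_rank_zero) (hWu : sha_dvd_analyticSha)
    (hGZK : rank_eq_analyticRank_of_analyticRank_le_one) (hmod : hasEntireLFunction_rat)
    (hnf : exists_isNewformOf) (hHL : HoffsteinLuo1997_exists_twist_L_one_ne_zero)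
    (hMaz : mazur_not_dvd_maninConstant_of_odd)
    (hPT : ∀ (K : Type) [Field K] [NumberField K], poitouTate_sum_localTatePairing_eq_zero K)
    -- PUBLISHED: road (a)'s five, Matar–Nekovář 2019 Thm. 0.3, Hsieh 2014 Thm. 1 (NO `hFH`, NO `hBR`)
    (hSkA : thmA_charIdeal_multiplicative) (hJn : thm61_nonsplitMultiplicative)
    (hHn : exists_isMultCanonical) (hD : thm1_padicBSD_rankOne_multiplicative)
    (hpar : nonempty_modularParametrizationData)
    (hMN : ∀ (N : ℕ) [NeZero N] (W : WeierstrassCurve ℚ) (K : Type) [Field K] [NumberField K],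
      MatarNekovar2019.thm03_padicValNat_card_sha_le_of_irreducible N W K)
    (hH : hsieh2014_exists_anticyclotomicPAdicLFunction)
    -- ROAD (a) NONSPLIT(3) ∧ (ram): Schneider at 3
    (hReg : ∀ (W : WeierstrassCurve ℚ) [W.IsElliptic] [W.IsGloballyMinimal],
      ClassX11b W 3 → Ram W 3 → ¬ W.HasSplitMultiplicativeReductionAtPrime 3 →
        ClassClosure.RegulatorNonvanishingAt W 3)
    -- ROADS (b)/(d): the named descent residual …
    (hDb : ∀ (W : WeierstrassCurve ℚ) [W.IsElliptic] [W.IsGloballyMinimal],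
      ClassX11b W 3 → Ram W 3 → W.HasSplitMultiplicativeReductionAtPrime 3 → HsiehDescentAt₃ W)
    (hDd : ∀ (W : WeierstrassCurve ℚ) [W.IsElliptic] [W.IsGloballyMinimal],
      ClassX11b W 3 → ¬ Ram W 3 → Surj W 3 → HsiehDescentAt₃ W)
    -- … and the halves H2 ∧ H3
    (hHb : ∀ (W : WeierstrassCurve ℚ) [W.IsElliptic] [W.IsGloballyMinimal],
      ClassX11b W 3 → Ram W 3 → W.HasSplitMultiplicativeReductionAtPrime 3 →
        BDPValueAt₃ W ∧ IMCDivAt₃ W)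
    (hHd : ∀ (W : WeierstrassCurve ℚ) [W.IsElliptic] [W.IsGloballyMinimal],
      ClassX11b W 3 → ¬ Ram W 3 → Surj W 3 → BDPValueAt₃ W ∧ IMCDivAt₃ W)
    -- pure-(T2β)@3 on split ∧ (ram): the CONSUMED Euler-system half (replaces the displays binder `hSh`)
    (hUβ : ∀ (W : WeierstrassCurve ℚ) [W.IsElliptic] [W.IsGloballyMinimal],
      ClassX11b W 3 → Ram W 3 → W.HasSplitMultiplicativeReductionAtPrime 3 → ¬ ShapeAlpha W →
        ¬ ShapeGamma W → 3 ∣ W.tamagawaProduct → Typed.MissingUpperBoundAt W 3)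
    -- (T2′)₃ Euler-system halves (α, γ∖α split, ¬ram)
    (hUα : ∀ (W : WeierstrassCurve ℚ) [W.IsElliptic] [W.IsGloballyMinimal],
      ClassX11b W 3 → Ram W 3 → ShapeAlpha W → Typed.MissingUpperBoundAt W 3)
    (hUγ : ∀ (W : WeierstrassCurve ℚ) [W.IsElliptic] [W.IsGloballyMinimal],
      ClassX11b W 3 → Ram W 3 → W.HasSplitMultiplicativeReductionAtPrime 3 → ¬ ShapeAlpha W →
        ShapeGamma W → Typed.MissingUpperBoundAt W 3)
    (hU₀ : ∀ (W : WeierstrassCurve ℚ) [W.IsElliptic] [W.IsGloballyMinimal],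
      ClassX11b W 3 → Surj W 3 → ¬ Ram W 3 → Typed.MissingUpperBoundAt W 3)
    -- THE (T4″)₃ CORNER `¬Surj`
    (hCL : ∀ (W : WeierstrassCurve ℚ) [W.IsElliptic] [W.IsGloballyMinimal], CornerStepLAt W)
    (hCT : ∀ (W : WeierstrassCurve ℚ) [W.IsElliptic] [W.IsGloballyMinimal], CornerTwistAt W)
    (hCU : ∀ (W : WeierstrassCurve ℚ) [W.IsElliptic] [W.IsGloballyMinimal], CornerUpperAt W) :
    MultiplicativeRankOneAtThree := by
  intro W _ _ hX
  have hEP : ∀ (K : Type) [Field K] [NumberField K] (v : HeightOneSpectrum (𝓞 K)),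
      localEulerPoincareCharacteristic (v.adicCompletion K) :=
    GaloisImage.EP.localEulerPoincareCharacteristic_adicCompletion
  by_cases hram : Ram W 3
  · by_cases hs : W.HasSplitMultiplicativeReductionAtPrime 3
    · -- road (b): StepLAt W from the named descent residual + H2 ∧ H3 at W
      have hL : StepLAt W :=
        stepLAt_of_halves₃_of_classX11b hnf hKo hPT hEP hX
          (bdpExistsAt₃_of_hsieh2014_of_descent W hH lambdaSupplyAt₃ (hDb W hX hram hs))
          (hHb W hX hram hs).1 (hHb W hX hram hs).2
      exact Three.bsdp_three_of_surj_of_stepLAt_of_shapes_upper hGZ hKo hB hSk hWu hGZK hmod hnf hHL hMaz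
        hPT hEP W hX (surj_of_irr_of_ram W 3 hX.2.2.2 hram) hL
        (fun hram hα hγ ht ↦ hUβ W hX hram hs hα hγ ht) (fun hram hα ↦ hUα W hX hram hα)
        (fun hram hα hγ ↦ hUγ W hX hram hs hα hγ) (fun h ↦ absurd hram h)
    · -- road (a)
      exact bsdp_of_ram_of_nonsplit_of_regulatorNonvanishing hSkA hJn hHn hD hGZK hpar W 3 hX hram hs
        (hReg W hX hram hs)
  · by_cases hsurj : Surj W 3
    · -- road (d)
      have hL₀ : StepLAt W :=
        stepLAt_of_halves₃_of_classX11b hnf hKo hPT hEP hX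
          (bdpExistsAt₃_of_hsieh2014_of_descent W hH lambdaSupplyAt₃ (hDd W hX hram hsurj))
          (hHd W hX hram hsurj).1 (hHd W hX hram hsurj).2
      exact Three.bsdp_three_of_surj_of_stepLAt_of_shapes_upper hGZ hKo hB hSk hWu hGZK hmod hnf hHL hMaz
        hPT hEP W hX hsurj hL₀ (fun h _ _ _ ↦ absurd h hram) (fun h _ ↦ absurd h hram)
        (fun h _ _ ↦ absurd h hram) (fun _ ↦ hU₀ W hX hsurj hram)
    · -- the corner, as v4.1: the ℚ-level Euler-system half from (U♯) + (Tw), then the split dichotomy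
      have hU : ∀ (W : WeierstrassCurve ℚ) [W.IsElliptic] [W.IsGloballyMinimal],
          ClassX11b W 3 → ¬ Surj W 3 → 3 ∣ W.tamagawaProduct → Typed.MissingUpperBoundAt W 3 :=
        fun W _ _ hX hns ht ↦
          missingUpperBoundAt_of_cornerUpperAt hGZ hKo hGZK hmod hnf hHL hMaz W hX hns ht (hCU W) (hCT W)
      obtain ⟨hdvd, hnr⟩ := ClassX11b.dvd_and_not_ram_of_not_surj W 3 hX hsurj
      refine Typed.bsdp_of_missingPPartAt W 3 hGZK (by rw [hX.1]) ?_
      by_cases hs : W.HasSplitMultiplicativeReductionAtPrime 3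
      · exact missingPPartAt_of_corner_split_of_inputs hGZ hKo hGZK hmod hnf hHL hMaz hPT hEP hMN
          (fun W _ _ ↦ hCL W) (fun W _ _ ↦ hCT W) hU W hX hsurj hdvd hnr hs
      · exact missingPPartAt_of_corner_nonsplit_of_inputs hGZ hKo hGZK hmod hnf hHL hMaz hPT hEP hMN
          (fun W _ _ ↦ hCL W) (fun W _ _ ↦ hCT W) hU W hX hsurj hdvd hnr hs

/-! ### §3. The K2@3 leaf from the KOLY record, re-keyed on the consumed bound -/

/-- **K2b leaf from the KOLY RECORD, the displays binder replaced by the CONSUMED upper bound.**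
`X11b.multiplicativeRankOneAtThree_of_kolyRecord` (`Theorems/RungK2HubKoly.lean` = `Three.forall_bsdp_of_kolyRecord`)
with `hSh` REPLACED by `hUβ : ∀ W, ClassX11b W 3 → Ram W 3 → split at 3 → ¬ShapeAlpha W → ¬ShapeGamma W → 3 ∣ ∏c →
Typed.MissingUpperBoundAt W 3` and `hFH`, `hBR` dropped; every other binder VERBATIM (the Kolyvagin road `hA1` on
A1 = (ram) ∧ `3 ∤ ∏c`; road (a) `hReg` and road (b)'s halves `hHb` on the Tamagawa cells; `hDb`, `hUα`, `hUγ`,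
`hDd`, `hHd`, `hU₀`, corner `hCL`, `hCT`, `hCU`). Proof: the koly record's pointwise case split with §1 in
place of `Three.bsdp_three_of_surj_of_stepLAt_of_shapes`. No new mathematics. CONDITIONAL on every binder;
nothing booked; O2 OPEN.
-- adapted from Summits/BirchSwinnertonDyer/Rank1Residual/X11b/Three/ClassRecordKoly.lean
[cite: Castella2018, Thm. 2.3 (p. 5), Thm. 3.2 (p. 9), §5 (p. 12)] [cite: Skinner2016PacificMC, Thm. A and Thm. C (§1)]
[cite: McCallumLMS1991, §5 Cor. 5.6 (p. 310)] [cite: MatarNekovar2019, Thm. 0.3 (p. 456)] -/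
theorem multiplicativeRankOneAtThree_of_kolyRecord_upper
    -- PUBLISHED: the named facts of route p2, WITHOUT `hEP` (as v4.5′)
    (hGZ : ∀ (N : ℕ) [NeZero N] (W : WeierstrassCurve ℚ) (K : Type) [Field K] [NumberField K],
      gross_zagier N W K)
    (hKo : ∀ (N : ℕ) [NeZero N] (W : WeierstrassCurve ℚ) (K : Type) [Field K] [NumberField K],
      kolyvagin N W K)
    (hB : ∀ (N : ℕ) [NeZero N] (W : WeierstrassCurve ℚ) (K : Type) [Field K] [NumberField K],
      Kolyvagin1990_padicValNat_card_sha_le N W K)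
    (hSk : Skinner2016.thmC_padicValRat_bsd_rank_zero) (hWu : sha_dvd_analyticSha)
    (hGZK : rank_eq_analyticRank_of_analyticRank_le_one) (hmod : hasEntireLFunction_rat)
    (hnf : exists_isNewformOf) (hHL : HoffsteinLuo1997_exists_twist_L_one_ne_zero)
    (hMaz : mazur_not_dvd_maninConstant_of_odd)
    (hPT : ∀ (K : Type) [Field K] [NumberField K], poitouTate_sum_localTatePairing_eq_zero K)
    -- PUBLISHED: road (a)'s five, Matar–Nekovář 2019 Thm. 0.3, Hsieh 2014 Thm. 1 (NO `hFH`, NO `hBR`)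
    (hSkA : thmA_charIdeal_multiplicative) (hJn : thm61_nonsplitMultiplicative)
    (hHn : exists_isMultCanonical) (hD : thm1_padicBSD_rankOne_multiplicative)
    (hpar : nonempty_modularParametrizationData)
    (hMN : ∀ (N : ℕ) [NeZero N] (W : WeierstrassCurve ℚ) (K : Type) [Field K] [NumberField K],
      MatarNekovar2019.thm03_padicValNat_card_sha_le_of_irreducible N W K)
    (hH : hsieh2014_exists_anticyclotomicPAdicLFunction)
    -- THE KOLYVAGIN ROAD on A1 = (ram) ∧ 3 ∤ ∏c
    (hA1 : ∀ (W : WeierstrassCurve ℚ) [W.IsElliptic] [W.IsGloballyMinimal],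
      ClassX11b W 3 → Ram W 3 → ¬ 3 ∣ W.tamagawaProduct → BSDp W 3)
    -- ROAD (a) NONSPLIT(3) ∧ (ram) ∧ 3 ∣ ∏c: Schneider at 3, RESTRICTED to the Tamagawa cells
    (hReg : ∀ (W : WeierstrassCurve ℚ) [W.IsElliptic] [W.IsGloballyMinimal],
      ClassX11b W 3 → Ram W 3 → ¬ W.HasSplitMultiplicativeReductionAtPrime 3 → 3 ∣ W.tamagawaProduct →
        ClassClosure.RegulatorNonvanishingAt W 3)
    -- ROAD (b) SPLIT(3) ∧ (ram): the named descent residual …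
    (hDb : ∀ (W : WeierstrassCurve ℚ) [W.IsElliptic] [W.IsGloballyMinimal],
      ClassX11b W 3 → Ram W 3 → W.HasSplitMultiplicativeReductionAtPrime 3 → HsiehDescentAt₃ W)
    -- … and the halves H2 ∧ H3, RESTRICTED to the Tamagawa cells
    (hHb : ∀ (W : WeierstrassCurve ℚ) [W.IsElliptic] [W.IsGloballyMinimal],
      ClassX11b W 3 → Ram W 3 → W.HasSplitMultiplicativeReductionAtPrime 3 → 3 ∣ W.tamagawaProduct →
        BDPValueAt₃ W ∧ IMCDivAt₃ W)
    -- pure-(T2β)@3 on split ∧ (ram): the CONSUMED Euler-system half (replaces the displays binder `hSh`)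
    (hUβ : ∀ (W : WeierstrassCurve ℚ) [W.IsElliptic] [W.IsGloballyMinimal],
      ClassX11b W 3 → Ram W 3 → W.HasSplitMultiplicativeReductionAtPrime 3 → ¬ ShapeAlpha W →
        ¬ ShapeGamma W → 3 ∣ W.tamagawaProduct → Typed.MissingUpperBoundAt W 3)
    -- (T2′)₃ Euler-system halves (as v4.5′)
    (hUα : ∀ (W : WeierstrassCurve ℚ) [W.IsElliptic] [W.IsGloballyMinimal],
      ClassX11b W 3 → Ram W 3 → ShapeAlpha W → Typed.MissingUpperBoundAt W 3)
    (hUγ : ∀ (W : WeierstrassCurve ℚ) [W.IsElliptic] [W.IsGloballyMinimal],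
      ClassX11b W 3 → Ram W 3 → W.HasSplitMultiplicativeReductionAtPrime 3 → ¬ ShapeAlpha W →
        ShapeGamma W → Typed.MissingUpperBoundAt W 3)
    -- ROAD (d) `¬Ram ∧ Surj` (as v4.5′)
    (hDd : ∀ (W : WeierstrassCurve ℚ) [W.IsElliptic] [W.IsGloballyMinimal],
      ClassX11b W 3 → ¬ Ram W 3 → Surj W 3 → HsiehDescentAt₃ W)
    (hHd : ∀ (W : WeierstrassCurve ℚ) [W.IsElliptic] [W.IsGloballyMinimal],
      ClassX11b W 3 → ¬ Ram W 3 → Surj W 3 → BDPValueAt₃ W ∧ IMCDivAt₃ W)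
    (hU₀ : ∀ (W : WeierstrassCurve ℚ) [W.IsElliptic] [W.IsGloballyMinimal],
      ClassX11b W 3 → Surj W 3 → ¬ Ram W 3 → Typed.MissingUpperBoundAt W 3)
    -- THE (T4″)@3 CORNER (as v4.5′)
    (hCL : ∀ (W : WeierstrassCurve ℚ) [W.IsElliptic] [W.IsGloballyMinimal], CornerStepLAt W)
    (hCT : ∀ (W : WeierstrassCurve ℚ) [W.IsElliptic] [W.IsGloballyMinimal], CornerTwistAt W)
    (hCU : ∀ (W : WeierstrassCurve ℚ) [W.IsElliptic] [W.IsGloballyMinimal], CornerUpperAt W) :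
    MultiplicativeRankOneAtThree := by
  intro W _ _ hX
  have hEP : ∀ (K : Type) [Field K] [NumberField K] (v : HeightOneSpectrum (𝓞 K)),
      localEulerPoincareCharacteristic (v.adicCompletion K) :=
    GaloisImage.EP.localEulerPoincareCharacteristic_adicCompletion
  by_cases hram : Ram W 3
  · by_cases htam : 3 ∣ W.tamagawaProduct
    · by_cases hs : W.HasSplitMultiplicativeReductionAtPrime 3
      · -- road (b) on the Tamagawa cells: StepLAt W from the named descent residual + H2 ∧ H3 at W
        have hL : StepLAt W :=
          stepLAt_of_halves₃_of_classX11b hnf hKo hPT hEP hX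
            (bdpExistsAt₃_of_hsieh2014_of_descent W hH lambdaSupplyAt₃ (hDb W hX hram hs))
            (hHb W hX hram hs htam).1 (hHb W hX hram hs htam).2
        exact Three.bsdp_three_of_surj_of_stepLAt_of_shapes_upper hGZ hKo hB hSk hWu hGZK hmod hnf hHL hMaz
          hPT hEP W hX (surj_of_irr_of_ram W 3 hX.2.2.2 hram) hL
          (fun hram hα hγ ht ↦ hUβ W hX hram hs hα hγ ht) (fun hram hα ↦ hUα W hX hram hα)
          (fun hram hα hγ ↦ hUγ W hX hram hs hα hγ) (fun h ↦ absurd hram h)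
      · -- road (a) on the Tamagawa cells
        exact bsdp_of_ram_of_nonsplit_of_regulatorNonvanishing hSkA hJn hHn hD hGZK hpar W 3 hX hram hs
          (hReg W hX hram hs htam)
    · -- A1: the Kolyvagin road decides
      exact hA1 W hX hram htam
  · by_cases hsurj : Surj W 3
    · -- road (d), as v4.5′
      have hL₀ : StepLAt W :=
        stepLAt_of_halves₃_of_classX11b hnf hKo hPT hEP hX
          (bdpExistsAt₃_of_hsieh2014_of_descent W hH lambdaSupplyAt₃ (hDd W hX hram hsurj))
          (hHd W hX hram hsurj).1 (hHd W hX hram hsurj).2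
      exact Three.bsdp_three_of_surj_of_stepLAt_of_shapes_upper hGZ hKo hB hSk hWu hGZK hmod hnf hHL hMaz
        hPT hEP W hX hsurj hL₀ (fun h _ _ _ ↦ absurd h hram) (fun h _ ↦ absurd h hram)
        (fun h _ _ ↦ absurd h hram) (fun _ ↦ hU₀ W hX hsurj hram)
    · -- the corner, as v4.1
      have hU : ∀ (W : WeierstrassCurve ℚ) [W.IsElliptic] [W.IsGloballyMinimal],
          ClassX11b W 3 → ¬ Surj W 3 → 3 ∣ W.tamagawaProduct → Typed.MissingUpperBoundAt W 3 :=
        fun W _ _ hX hns ht ↦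
          missingUpperBoundAt_of_cornerUpperAt hGZ hKo hGZK hmod hnf hHL hMaz W hX hns ht (hCU W) (hCT W)
      obtain ⟨hdvd, hnr⟩ := ClassX11b.dvd_and_not_ram_of_not_surj W 3 hX hsurj
      refine Typed.bsdp_of_missingPPartAt W 3 hGZK (by rw [hX.1]) ?_
      by_cases hs : W.HasSplitMultiplicativeReductionAtPrime 3
      · exact missingPPartAt_of_corner_split_of_inputs hGZ hKo hGZK hmod hnf hHL hMaz hPT hEP hMN
          (fun W _ _ ↦ hCL W) (fun W _ _ ↦ hCT W) hU W hX hsurj hdvd hnr hs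
      · exact missingPPartAt_of_corner_nonsplit_of_inputs hGZ hKo hGZK hmod hnf hHL hMaz hPT hEP hMN
          (fun W _ _ ↦ hCL W) (fun W _ _ ↦ hCT W) hU W hX hsurj hdvd hnr hs

end Summit.BirchSwinnertonDyer.BirchSwinnertonDyer.Theorems

end
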